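import Literature.RepresentationTheory.HeisenbergGroup.SchrodingerBigCellSection
import Literature.RepresentationTheory.HeisenbergGroup.ImplementerExtensionIso
import Literature.NumberTheory.Weil1964.LocalLerayCocyclePiBigCell
import Literature.GroupTheory.GroupChunkExtension
import HarnessLib

/-!
# The metaplectic cocycle of the Schrödinger model on `𝒮(F^ι)` IS the Leray (Perrin–Rao) cocycle
# (Rao's Theorem 4.1 / MVW Chap. 3 §I.3), via the big cell

Topic `RepresentationTheory/HeisenbergGroup`; namespace `Literature.RepresentationTheory.HeisenbergGroup`. KERNEL
mathematics only (definitions with bodies + theorems; no named fact, no `axiom`, no `sorry`).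

Setting: `F` a non-archimedean local field with `2` invertible, `ψ` a non-trivial continuous character with
conductor exponent `m`, `μ` the SELF-DUAL Haar measure, `W = F^ι ⊕ F^ι` with Weil's form
`A = alt (polar (dotProductBilin F F))`, `ℓ_Y = 0 ⊕ F^ι`, `ρ = schrodingerSB` the smooth Schrödinger model on
`𝒮(F^ι)`, `S̃p_ψ(W) = MpPsi ρ` MVW's group of pairs `(g, M)`.

* §1 **the multiplier relation on the big cell for the Leray cocycle of `ψ(½·)`**
  (`hasMultiplierOn_bigCellOp`): for `g₁, g₂, g₁g₂ ∈ Ω = {B invertible}`,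
  `r(g₁) r(g₂) = c_{ℓ_Y}^{ψ(½·)}(g₁, g₂) · r(g₁g₂)` for the big-cell section `r = bigCellOp` — Weil's
  `r(s)r(s') = γ(f₀) r(s'')` (`bigCellOp_mul_bigCellOp`, `κ(T) = γ_ψ(-q_T)` for the self-dual measure) matched with
  `c_{ℓ_Y}^{ψ'}(g₁, g₂) = γ_{ψ'₂}(-q_T)` (`lerayCocycle_canonicalWord_eq_weilIndexQF`) at `ψ' = ψ(½·)`, `ψ'₂ = ψ` —
  this is [Rangarao1993] Thm 4.1 (5) on the big cell, "`c(σ₁, σ₂) =` Weil index of `χ(½⟨x, xρ⟩)`, `ρ` the Leray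
  invariant", the `½` being carried here by the character.
* §2 **extension off the big cell by Weil's group-chunk lemma** ([Weil1964] n° 42 Lemme 6, n° 43; tree
  `HasMultiplierOn.lift`): `Ω` is left-generic (`isLeftGeneric_bigCell`, a local field being infinite), so there is
  a unique `r : Sp(W) → GL(𝒮(F^ι))` agreeing with `bigCellOp` on `Ω` with
  `r(g₁) r(g₂) = c_{ℓ_Y}^{ψ(½·)}(g₁, g₂) r(g₁g₂)` for ALL `g₁, g₂` (`schrodingerLeraySection`); every `r(g)`
  implements `g` (`r(g) = r(x)⁻¹ c · r(xg)` with `x, xg ∈ Ω`), so `r` is a normalised `ImplementerSection` of `ρ`.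
* §3 **THE JUNCTION** (`schrodingerCocyclePi_eq_lerayCentralCocycle`): the cocycle of this section of the
  Schrödinger model (tree `schrodingerCocyclePi`, [MoeglinVignerasWaldspurger1987] Chap. 2 II.1) EQUALS the
  Leray–Perrin–Rao cocycle `lerayCentralCocycle μ ψ(½·) A ℓ_Y` of `Weil1964/LocalLerayCocycle.lean`
  ([MoeglinVignerasWaldspurger1987] Chap. 3 §I.3 Théorème: "`c(g, g') = γ(ψ ∘ ½ q(g, g'))`"; [Rangarao1993]
  Thm 4.1 (5); [Perrin1981]); consequently **`M̃p_{ψ(½·), ℓ_Y}(W) ≃* S̃p_ψ(W)` over `Sp(W)` and under `ℂˣ`**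
  (`lerayMetaplecticEquivMpPsi`), so the metaplectic class of `𝒮(F^ι)` (`ImplementerCocycleClass.lean`) is the
  Leray class.

## References

* [Rangarao1993] R. Ranga Rao, *On some explicit formulas in the theory of Weil representation*, Pacific J. Math.
  157 (1993): Thm 4.1 p. 358 and its proof p. 359; p. 336.
* [MoeglinVignerasWaldspurger1987] C. Mœglin, M.-F. Vignéras, J.-L. Waldspurger, *Correspondances de Howe sur un
  corps p-adique*, LNM 1291 (1987): Chap. 2 II.1, Chap. 3 §I.3 Théorème ([P], [Rao]).
* [Weil1964] A. Weil, Acta Math. 111 (1964): n° 15 Thm 3, n° 42 Lemme 6, n° 43.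
* [Perrin1981] P. Perrin, *Représentations de Schrödinger, indice de Maslov et groupe metaplectique*, LNM 880 (1981).
-/

set_option autoImplicit false

noncomputable section

namespace Literature.RepresentationTheory.HeisenbergGroup

open _root_.MeasureTheory Matrix Filter
open Literature.GroupTheory
open Literature.NumberTheory.Automorphic
open Literature.NumberTheory.GaloisRepresentations.IsNonarchimedeanLocalField
open Literature.NumberTheory.Weil1964
open Literature.LinearAlgebra.QuadraticForm

/-! ## §0 Plumbing: equal cocycles, the scalar homomorphism, infinitude of `F` -/

section Congr

variable {G : Type*} {A : Type*} [Group G] [CommGroup A]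

/-- equal cocycles have isomorphic twisted products (the identity on pairs `(g, a)`).
[cite: MoeglinVignerasWaldspurger1987, Chap. 2 II.1 (B)] -/
def twistedProductCongr {c c' : CentralCocycle G A} (h : c = c') : TwistedProduct c ≃* TwistedProduct c' where
  toFun x := ⟨x.g, x.a⟩
  invFun y := ⟨y.g, y.a⟩
  left_inv _ := rfl
  right_inv _ := rfl
  map_mul' x y := by subst h; rfl

/-- `(g, a) ↦ (g, a)`: the `G`-coordinate. [cite: MoeglinVignerasWaldspurger1987, Chap. 2 II.1 (B)] -/
@[simp] theorem twistedProductCongr_g {c c' : CentralCocycle G A} (h : c = c') (x : TwistedProduct c) :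
    (twistedProductCongr h x).g = x.g := rfl

/-- `(g, a) ↦ (g, a)`: the `A`-coordinate. [cite: MoeglinVignerasWaldspurger1987, Chap. 2 II.1 (B)] -/
@[simp] theorem twistedProductCongr_a {c c' : CentralCocycle G A} (h : c = c') (x : TwistedProduct c) :
    (twistedProductCongr h x).a = x.a := rfl

end Congr

section Scalars

variable {F : Type*} [Field F] [TopologicalSpace F] {ι : Type*}

/-- the scalars `ℂˣ → GL(𝒮(F^ι))`, `u ↦ u·1`, as a homomorphism. [cite: MoeglinVignerasWaldspurger1987, Chap. 2 II.1 (B)] -/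
def scalarOpHom : ℂˣ →* (SchwartzBruhat (ι → F) ≃ₗ[ℂ] SchwartzBruhat (ι → F)) where
  toFun := scalarOp
  map_one' := LinearEquiv.ext fun f => by rw [scalarOp_apply, Units.val_one, one_smul]; rfl
  map_mul' u v := LinearEquiv.ext fun f => by
    rw [LinearEquiv.mul_apply, scalarOp_apply, scalarOp_apply, scalarOp_apply, Units.val_mul, mul_smul]

omit [Field F] in
/-- formula. [cite: MoeglinVignerasWaldspurger1987, Chap. 2 II.1 (B)] -/
@[simp] theorem scalarOpHom_apply (u : ℂˣ) :
    scalarOpHom (F := F) (ι := ι) u = scalarOp (S := SchwartzBruhat (ι → F)) u := rfl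

omit [Field F] in
/-- scalars are central. [cite: MoeglinVignerasWaldspurger1987, Chap. 2 II.1 (B)] -/
theorem scalarOpHom_mem_center (u : ℂˣ) :
    scalarOpHom (F := F) (ι := ι) u ∈ Subgroup.center (SchwartzBruhat (ι → F) ≃ₗ[ℂ] SchwartzBruhat (ι → F)) := by
  rw [Subgroup.mem_center_iff]
  intro A
  apply LinearEquiv.ext; intro f
  rw [LinearEquiv.mul_apply, LinearEquiv.mul_apply, scalarOpHom_apply, scalarOp_apply, scalarOp_apply, map_smul]

/-- `u ↦ u·1` is injective on `𝒮(F^ι) ≠ 0`. [cite: MoeglinVignerasWaldspurger1987, Chap. 2 II.1 (B)] -/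
theorem scalarOpHom_injective [ValuativeRel F] [IsNonarchimedeanLocalField F] [Fintype ι] :
    Function.Injective (scalarOpHom (F := F) (ι := ι)) := fun u v h => by
  obtain ⟨f, hf⟩ := exists_ne (0 : SchwartzBruhat (ι → F))
  have h1 := LinearEquiv.congr_fun h f
  rw [scalarOpHom_apply, scalarOpHom_apply, scalarOp_apply, scalarOp_apply] at h1
  exact Units.ext (smul_left_injective ℂ hf h1)

end Scalars

section Junction

variable {F : Type*} [Field F] [ValuativeRel F] [TopologicalSpace F] [IsNonarchimedeanLocalField F]
  {ι : Type*} [Fintype ι] [DecidableEq ι] [Invertible (2 : F)]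
  {ψ : AddChar F Circle} (hl : IsLocallyConstant (⇑ψ : F → Circle))
  (hb : ∀ y : ι → F, Continuous fun u : ι → F => dotProductBilin F F u y)
  [MeasurableSpace F] [BorelSpace F] (μ : Measure F) [μ.IsAddHaarMeasure] {m : ℤ}

local notation "𝕍" => ((ι → F) × (ι → F))
local notation "Spι" => (symplecticGroup (polar (dotProductBilin F F (m := ι))))
local notation "ℓY" => (Submodule.prod (⊥ : Submodule F (ι → F)) (⊤ : Submodule F (ι → F)))
local notation "𝔸" => (alt (polar (dotProductBilin F F (m := ι))))

omit [DecidableEq ι] [Invertible (2 : F)] [MeasurableSpace F] [BorelSpace F] in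
/-- a non-archimedean local field is infinite (the powers of an element of valuation `< 1` are distinct).
[cite: WeilBNT1967, Ch. I §4, Prop. 4] -/
private theorem infinite_localField : Infinite F := by
  obtain ⟨x, hx0, hx1⟩ := Valuation.IsNontrivial.exists_lt_one (v := ValuativeRel.valuation F)
  have hpos : 0 < ValuativeRel.valuation F x := zero_lt_iff.2 ((Valuation.ne_zero_iff _).2 hx0)
  have hanti : StrictAnti fun n : ℕ => (ValuativeRel.valuation F x) ^ n := fun m n hmn =>
    pow_lt_pow_right_of_lt_one₀ hpos hx1 hmn
  refine Infinite.of_injective (fun n : ℕ => x ^ n) fun m n hmn => ?_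
  have h : (ValuativeRel.valuation F x) ^ m = (ValuativeRel.valuation F x) ^ n := by
    rw [← map_pow, ← map_pow]
    exact congrArg _ hmn
  exact hanti.injective h

omit [DecidableEq ι] [MeasurableSpace F] [BorelSpace F] in
/-- `ψ(½·)` is again continuous and non-trivial. [cite: MoeglinVignerasWaldspurger1987, Chap. 3 §I.3] -/
theorem isContinuousNontrivial_mulShift_half (hψ : ψ.IsContinuousNontrivial) :
    (ψ.mulShift (⅟(2 : F))).IsContinuousNontrivial :=
  isContinuousNontrivial_mulShift_of_ne_zero hψ (invertibleInvOf (a := (2 : F))).ne_zero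

omit [DecidableEq ι] [Invertible (2 : F)] [MeasurableSpace F] [BorelSpace F] in
/-- **the big cell `Ω = {g : B invertible}` of `Sp(F^ι ⊕ F^ι)` is left-generic** (every finite family has a common
left translate into `Ω`; a local field is infinite). [cite: Weil1964, n° 42 Lemme 6 (hypothesis), p. 195; n° 33] -/
theorem isLeftGeneric_bigCellPi : IsLeftGeneric {g : Spι | Function.Bijective (blockB (g : 𝕍 ≃ₗ[F] 𝕍))} := by
  haveI : Infinite F := infinite_localField
  intro T
  obtain ⟨x, hx⟩ := isLeftGeneric_bigCell (B := 𝔸) (ℓ := ℓY) isAlt_alt_polar_dotProductBilin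
    nondegenerate_alt_polar_dotProductBilin orthogonal_prod_bot_top T
  exact ⟨x, fun t ht => blockB_bijective_of_mem_bigCell _ (hx t ht)⟩

/-! ## §1 The multiplier relation on the big cell for the Leray cocycle of `ψ(½·)` -/

/-- **the Leray cocycle of `Sp(F^ι ⊕ F^ι)` for `ℓ_Y` and the character `ψ(½·)`** — `c(g₁, g₂) = γ_{ψ(½·)}(τ(ℓ_Y,
g₁ℓ_Y, g₁g₂ℓ_Y))`, MVW's "`γ(ψ ∘ ½ q(g, g'))`". [cite: MoeglinVignerasWaldspurger1987, Chap. 3 §I.3; Rangarao1993, Thm 4.1 (5)] -/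
def lerayCocycleHalf (hψ : ψ.IsContinuousNontrivial) : CentralCocycle Spι ℂˣ :=
  lerayCentralCocycle μ (isContinuousNontrivial_mulShift_half hψ) (isAlt_alt_polar_dotProductBilin (F := F) (ι := ι))
    nondegenerate_alt_polar_dotProductBilin orthogonal_prod_bot_top

omit [DecidableEq ι] in
/-- unfolding: `lerayCocycleHalf` IS the tree's `lerayCentralCocycle` for `ψ(½·)`, `A`, `ℓ_Y`.
[cite: MoeglinVignerasWaldspurger1987, Chap. 3 §I.3] -/
theorem lerayCocycleHalf_eq (hψ : ψ.IsContinuousNontrivial) :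
    lerayCocycleHalf μ hψ = lerayCentralCocycle μ (isContinuousNontrivial_mulShift_half hψ)
      (isAlt_alt_polar_dotProductBilin (F := F) (ι := ι)) nondegenerate_alt_polar_dotProductBilin
      orthogonal_prod_bot_top := rfl

omit [DecidableEq ι] in
/-- value: `(c(g₁, g₂) : ℂ) = lerayCocycle ψ(½·) μ A ℓ_Y g₁ g₂`. [cite: MoeglinVignerasWaldspurger1987, Chap. 3 §I.3] -/
theorem coe_lerayCocycleHalf_apply (hψ : ψ.IsContinuousNontrivial) (g₁ g₂ : Spι) :
    ((lerayCocycleHalf μ hψ g₁ g₂ : ℂˣ) : ℂ) =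
      lerayCocycle (ψ.mulShift (⅟(2 : F))) μ 𝔸 ℓY (g₁ : 𝕍 ≃ₗ[F] 𝕍) (g₂ : 𝕍 ≃ₗ[F] 𝕍) := rfl

/-- **`r(g₁) r(g₂) = c_{ℓ_Y}^{ψ(½·)}(g₁, g₂) · r(g₁g₂)` for `g₁, g₂, g₁g₂` in the big cell**, `r = bigCellOp`
(self-dual measure): Weil's Thm 3 with `κ(T) = γ_ψ(-q_T) = γ'_{ψ(½·)}(2·(-q_T)) = c_{ℓ_Y}^{ψ(½·)}(g₁, g₂)`.
[cite: Rangarao1993, Thm 4.1 (4)–(5), p. 358; Weil1964, n° 15 Thm 3, p. 163] -/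
theorem hasMultiplierOn_bigCellOp (hψ : ψ.IsContinuousNontrivial) (hm : ψ.HasConductorExp m)
    (hμ : IsSelfDualMeasure ψ μ) :
    HasMultiplierOn (lerayCocycleHalf μ hψ) scalarOpHom {g : Spι | Function.Bijective (blockB (g : 𝕍 ≃ₗ[F] 𝕍))}
      (bigCellOp hl μ hψ hm) := by
  intro a ha b hb' hab
  simp only [Set.mem_setOf_eq] at ha hb' hab
  -- canonical words of `a`, `b`
  have ea := eq_canonicalWord a ha
  have eb := eq_canonicalWord b hb'
  have e := congrArg₂ (· * ·) ea eb
  -- the `B`-block of `ab` and the map `T = ᵗB₂(δ₁ + γ₂)B₂`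
  have hy : ∀ y, blockB ((a * b : Spι) : 𝕍 ≃ₗ[F] 𝕍) y =
      cellB (a : 𝕍 ≃ₗ[F] 𝕍) ha ((cellDelta (a : 𝕍 ≃ₗ[F] 𝕍) ha + cellGamma (b : 𝕍 ≃ₗ[F] 𝕍) hb')
        (cellB (b : 𝕍 ≃ₗ[F] 𝕍) hb' y)) := fun y => by
    rw [e]; exact blockB_canonicalWord_mul _ _ _ _ _ _ _ _ _ _ y
  let E : (ι → F) ≃ₗ[F] (ι → F) :=
    (cellB (b : 𝕍 ≃ₗ[F] 𝕍) hb').symm ≪≫ₗ (cellB ((a * b : Spι) : 𝕍 ≃ₗ[F] 𝕍) hab ≪≫ₗ (cellB (a : 𝕍 ≃ₗ[F] 𝕍) ha).symm)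
  have hE : ∀ y, E y = (cellDelta (a : 𝕍 ≃ₗ[F] 𝕍) ha + cellGamma (b : 𝕍 ≃ₗ[F] 𝕍) hb') y := fun y => by
    show (cellB (a : 𝕍 ≃ₗ[F] 𝕍) ha).symm (cellB ((a * b : Spι) : 𝕍 ≃ₗ[F] 𝕍) hab ((cellB (b : 𝕍 ≃ₗ[F] 𝕍) hb').symm y)) = _
    rw [cellB_apply _ hab, hy, LinearEquiv.apply_symm_apply, LinearEquiv.symm_apply_apply]
  let Tₑ : (ι → F) ≃ₗ[F] (ι → F) := cellB (b : 𝕍 ≃ₗ[F] 𝕍) hb' ≪≫ₗ (E ≪≫ₗ transposePi (cellB (b : 𝕍 ≃ₗ[F] 𝕍) hb'))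
  have hT : (Tₑ : (ι → F) →ₗ[F] (ι → F)) =
      ((transposePi (cellB (b : 𝕍 ≃ₗ[F] 𝕍) hb') : (ι → F) ≃ₗ[F] (ι → F)) : (ι → F) →ₗ[F] (ι → F)) ∘ₗ
        (cellDelta (a : 𝕍 ≃ₗ[F] 𝕍) ha + cellGamma (b : 𝕍 ≃ₗ[F] 𝕍) hb') ∘ₗ
        ((cellB (b : 𝕍 ≃ₗ[F] 𝕍) hb' : (ι → F) ≃ₗ[F] (ι → F)) : (ι → F) →ₗ[F] (ι → F)) := by
    apply LinearMap.ext; intro x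
    show transposePi (cellB (b : 𝕍 ≃ₗ[F] 𝕍) hb') (E (cellB (b : 𝕍 ≃ₗ[F] 𝕍) hb' x)) = _
    rw [hE]; rfl
  have hTs := symm_of_coe_eq (cellDelta_symm a ha) (cellGamma_symm b hb') _ Tₑ hT
  -- Weil's formula for the operators
  have hop := bigCellOp_mul_bigCellOp hl μ hψ hm _ _ _ _ (cellGamma_symm a ha) (cellDelta_symm a ha)
    (cellGamma_symm b hb') (cellDelta_symm b hb') (cellB (a : 𝕍 ≃ₗ[F] 𝕍) ha) (cellB (b : 𝕍 ≃ₗ[F] 𝕍) hb') Tₑ hT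
  -- the Leray value
  have hler := lerayCocycle_canonicalWord_eq_weilIndexQF μ (isContinuousNontrivial_mulShift_half hψ) _ _ _ _
    (cellGamma_symm a ha) (cellDelta_symm a ha) (cellGamma_symm b hb') (cellDelta_symm b hb')
    (cellB (a : 𝕍 ≃ₗ[F] 𝕍) ha) (cellB (b : 𝕍 ≃ₗ[F] 𝕍) hb') Tₑ hT
  rw [AddChar.mulShift_mulShift, invOf_mul_self, AddChar.mulShift_one,
    ← weilKappa_eq_weilIndexQF (hl := hl) (μ := μ) hψ hm hμ Tₑ hTs] at hler
  have hc : lerayCocycleHalf μ hψ a b = Units.mk0 (weilKappa μ (ψ := ψ) Tₑ) (weilKappa_ne_zero μ hψ Tₑ hTs) := by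
    ext
    rw [coe_lerayCocycleHalf_apply, Units.val_mk0, ← hler]
    exact congrArg₂ (fun g₁ g₂ : 𝕍 ≃ₗ[F] 𝕍 => lerayCocycle (ψ.mulShift (⅟(2 : F))) μ 𝔸 ℓY g₁ g₂)
      (congrArg Subtype.val ea) (congrArg Subtype.val eb)
  rw [congrArg (bigCellOp hl μ hψ hm) ea, congrArg (bigCellOp hl μ hψ hm) eb, congrArg (bigCellOp hl μ hψ hm) e, hop,
    hc, scalarOpHom_apply]

/-! ## §2 The section `r : Sp(W) → GL(𝒮(F^ι))` with multiplier the Leray cocycle -/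

/-- **the Schrödinger–Leray section**: the unique extension of the big-cell section `bigCellOp` to all of `Sp(W)`
with multiplier `c_{ℓ_Y}^{ψ(½·)}` (Weil's `r` of n° 43, through the group-chunk lemma in `Sp(W) ×_c ℂˣ`).
[cite: Weil1964, n° 43, pp. 196–197; Rangarao1993, Thm 4.1, p. 358] -/
def schrodingerLeraySection (hψ : ψ.IsContinuousNontrivial) (hm : ψ.HasConductorExp m)
    (hμ : IsSelfDualMeasure ψ μ) : Spι → (SchwartzBruhat (ι → F) ≃ₗ[ℂ] SchwartzBruhat (ι → F)) :=
  HasMultiplierOn.lift isLeftGeneric_bigCellPi scalarOpHom_mem_center (hasMultiplierOn_bigCellOp hl μ hψ hm hμ)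

/-- `r = bigCellOp` on the big cell. [cite: Weil1964, n° 43, pp. 196–197] -/
theorem schrodingerLeraySection_eq_of_bijective (hψ : ψ.IsContinuousNontrivial) (hm : ψ.HasConductorExp m)
    (hμ : IsSelfDualMeasure ψ μ) {g : Spι} (hg : Function.Bijective (blockB (g : 𝕍 ≃ₗ[F] 𝕍))) :
    schrodingerLeraySection hl μ hψ hm hμ g = bigCellOp hl μ hψ hm g :=
  HasMultiplierOn.lift_eq_of_mem (isLeftGeneric_bigCellPi (F := F) (ι := ι)) scalarOpHom_mem_center
    (hasMultiplierOn_bigCellOp hl μ hψ hm hμ) hg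

/-- `r(1) = 1`. [cite: Weil1964, n° 43, pp. 196–197] -/
theorem schrodingerLeraySection_one (hψ : ψ.IsContinuousNontrivial) (hm : ψ.HasConductorExp m)
    (hμ : IsSelfDualMeasure ψ μ) : schrodingerLeraySection hl μ hψ hm hμ (1 : Spι) = 1 :=
  HasMultiplierOn.lift_one (isLeftGeneric_bigCellPi (F := F) (ι := ι)) scalarOpHom_mem_center
    (hasMultiplierOn_bigCellOp hl μ hψ hm hμ)

/-- **`r(g₁) r(g₂) = c_{ℓ_Y}^{ψ(½·)}(g₁, g₂) r(g₁g₂)` for ALL `g₁, g₂ ∈ Sp(W)`**.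
[cite: Weil1964, n° 43, (40), pp. 196–197; Rangarao1993, (4.1) and Thm 4.1 (5), p. 358] -/
theorem hasMultiplier_schrodingerLeraySection (hψ : ψ.IsContinuousNontrivial) (hm : ψ.HasConductorExp m)
    (hμ : IsSelfDualMeasure ψ μ) :
    TwistedProduct.HasMultiplier (lerayCocycleHalf (ι := ι) μ hψ) scalarOpHom (schrodingerLeraySection hl μ hψ hm hμ) :=
  HasMultiplierOn.hasMultiplier_lift (isLeftGeneric_bigCellPi (F := F) (ι := ι)) scalarOpHom_mem_center
    (hasMultiplierOn_bigCellOp hl μ hψ hm hμ)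

/-- **every `r(g)` implements `g`**: `r(g) = r(x)⁻¹ c(x, g) r(xg)` with `x, xg` in the big cell, where `bigCellOp`
implements. [cite: MoeglinVignerasWaldspurger1987, Chap. 2 II.1 (A); Weil1964, n° 43] -/
theorem schrodingerLeraySection_mem_MpPsi (hψ : ψ.IsContinuousNontrivial) (hm : ψ.HasConductorExp m)
    (hμ : IsSelfDualMeasure ψ μ) (g : Spι) :
    (g, schrodingerLeraySection hl μ hψ hm hμ g) ∈ MpPsi (schrodingerSB (dotProductBilin F F (m := ι)) ψ hl hb) := by
  obtain ⟨x, hx, hxg⟩ := isLeftGeneric_bigCellPi.exists_mem_mul_mem g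
  rw [schrodingerLeraySection, HasMultiplierOn.lift_eq (isLeftGeneric_bigCellPi (F := F) (ι := ι)) scalarOpHom_mem_center
    (hasMultiplierOn_bigCellOp hl μ hψ hm hμ) hx hxg]
  have e : (g, (bigCellOp hl μ hψ hm x)⁻¹ * (scalarOpHom (lerayCocycleHalf μ hψ x g) * bigCellOp hl μ hψ hm (x * g))) =
      (x, bigCellOp hl μ hψ hm x)⁻¹ * (((1 : Spι), scalarOp (S := SchwartzBruhat (ι → F)) (lerayCocycleHalf μ hψ x g)) *
        (x * g, bigCellOp hl μ hψ hm (x * g))) := by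
    rw [Prod.inv_mk, Prod.mk_mul_mk, Prod.mk_mul_mk, one_mul, inv_mul_cancel_left, scalarOpHom_apply]
  rw [e]
  exact Subgroup.mul_mem _ (Subgroup.inv_mem _ (bigCellOp_mem_MpPsi hl hb μ hψ hm x hx))
    (Subgroup.mul_mem _ (one_scalarOp_mem_MpPsi _ _) (bigCellOp_mem_MpPsi hl hb μ hψ hm (x * g) hxg))

/-- **the Schrödinger–Leray section as a normalised section of implementers of `ρ`** (MVW's `r`).
[cite: MoeglinVignerasWaldspurger1987, Chap. 2 II.1 (A); Rangarao1993, Thm 3.5 / Lemma 3.2] -/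
def schrodingerLerayImplementerSection (hψ : ψ.IsContinuousNontrivial) (hm : ψ.HasConductorExp m)
    (hμ : IsSelfDualMeasure ψ μ) : ImplementerSection (schrodingerSB (dotProductBilin F F (m := ι)) ψ hl hb) where
  toFun := schrodingerLeraySection hl μ hψ hm hμ
  implements' g := (mem_MpPsi _ _).1 (schrodingerLeraySection_mem_MpPsi hl hb μ hψ hm hμ g)
  map_one' := schrodingerLeraySection_one hl μ hψ hm hμ

/-- its underlying function. [cite: MoeglinVignerasWaldspurger1987, Chap. 2 II.1 (A)] -/
@[simp] theorem schrodingerLerayImplementerSection_apply (hψ : ψ.IsContinuousNontrivial) (hm : ψ.HasConductorExp m)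
    (hμ : IsSelfDualMeasure ψ μ) (g : Spι) :
    schrodingerLerayImplementerSection hl hb μ hψ hm hμ g = schrodingerLeraySection hl μ hψ hm hμ g := rfl

/-! ## §3 The junction: the Schrödinger cocycle is the Leray cocycle -/

/-- **RAO'S THEOREM 4.1 / MVW Chap. 3 §I.3: the metaplectic cocycle of the Schrödinger model on `𝒮(F^ι)`
(for the Schrödinger–Leray section, self-dual measure) IS the Leray–Perrin–Rao cocycle of `ℓ_Y = 0 ⊕ F^ι` for the
character `ψ(½·)`**: `c_r(g₁, g₂) = γ_{ψ(½·)}(τ(ℓ_Y, g₁ℓ_Y, g₁g₂ℓ_Y))` for all `g₁, g₂ ∈ Sp(F^ι ⊕ F^ι)`.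
[cite: Rangarao1993, Thm 4.1 (5), p. 358; MoeglinVignerasWaldspurger1987, Chap. 3 §I.3 Théorème] -/
theorem schrodingerCocyclePi_eq_lerayCentralCocycle (hψ : ψ.IsContinuousNontrivial) (hm : ψ.HasConductorExp m)
    (hμ : IsSelfDualMeasure ψ μ) :
    schrodingerCocyclePi hl hb hψ (schrodingerLerayImplementerSection hl hb μ hψ hm hμ) =
      lerayCentralCocycle μ (isContinuousNontrivial_mulShift_half hψ) (isAlt_alt_polar_dotProductBilin (F := F) (ι := ι))
        nondegenerate_alt_polar_dotProductBilin orthogonal_prod_bot_top := by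
  have hr' : TwistedProduct.HasMultiplier (schrodingerCocyclePi hl hb hψ (schrodingerLerayImplementerSection hl hb μ hψ hm hμ))
      scalarOpHom (schrodingerLeraySection hl μ hψ hm hμ) := fun g g' => LinearEquiv.ext fun f => by
    rw [LinearEquiv.mul_apply, LinearEquiv.mul_apply, scalarOpHom_apply, scalarOp_apply]
    exact (schrodingerLerayImplementerSection hl hb μ hψ hm hμ).mul_apply
      (implementerUniqueUpToScalar_schrodingerSB_pi hl hb hψ) g g' f
  rw [← lerayCocycleHalf_eq μ hψ]
  exact (cocycle_eq_of_hasMultiplier scalarOpHom_injective (hasMultiplier_schrodingerLeraySection hl μ hψ hm hμ) hr').symm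

/-- pointwise: `c_r(g₁, g₂) = γ_{ψ(½·)}(τ(ℓ_Y, g₁ℓ_Y, g₁g₂ℓ_Y))` as complex numbers.
[cite: Rangarao1993, Thm 4.1 (5), p. 358] -/
theorem coe_schrodingerCocyclePi_apply (hψ : ψ.IsContinuousNontrivial) (hm : ψ.HasConductorExp m)
    (hμ : IsSelfDualMeasure ψ μ) (g₁ g₂ : Spι) :
    ((schrodingerCocyclePi hl hb hψ (schrodingerLerayImplementerSection hl hb μ hψ hm hμ) g₁ g₂ : ℂˣ) : ℂ) =
      lerayCocycle (ψ.mulShift (⅟(2 : F))) μ 𝔸 ℓY (g₁ : 𝕍 ≃ₗ[F] 𝕍) (g₂ : 𝕍 ≃ₗ[F] 𝕍) := by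
  rw [schrodingerCocyclePi_eq_lerayCentralCocycle]; rfl

/-- **`M̃p_{ψ(½·), ℓ_Y}(W) ≃* S̃p_ψ(W)`**: the central extension of `Sp(F^ι ⊕ F^ι)` by `ℂˣ` defined by the Leray
cocycle (`LerayMetaplectic`) is MVW's group of pairs of the Schrödinger model, by `(g, a) ↦ (g, a · r(g))`.
[cite: MoeglinVignerasWaldspurger1987, Chap. 2 II.1 (B) with Chap. 3 §I.3; Rangarao1993, §3.2] -/
def lerayMetaplecticEquivMpPsi (hψ : ψ.IsContinuousNontrivial) (hm : ψ.HasConductorExp m)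
    (hμ : IsSelfDualMeasure ψ μ) :
    LerayMetaplectic μ (isContinuousNontrivial_mulShift_half hψ) (isAlt_alt_polar_dotProductBilin (F := F) (ι := ι))
        nondegenerate_alt_polar_dotProductBilin orthogonal_prod_bot_top ≃*
      MpPsi (schrodingerSB (dotProductBilin F F (m := ι)) ψ hl hb) :=
  (twistedProductCongr (schrodingerCocyclePi_eq_lerayCentralCocycle hl hb μ hψ hm hμ).symm).trans
    (schrodingerTwistedProductEquivPi hl hb hψ (schrodingerLerayImplementerSection hl hb μ hψ hm hμ))

/-- **over `Sp(W)`**: the isomorphism commutes with the projections, `p(Φ(g, a)) = g`.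
[cite: MoeglinVignerasWaldspurger1987, Chap. 2 II.1 (B)] -/
theorem proj_lerayMetaplecticEquivMpPsi (hψ : ψ.IsContinuousNontrivial) (hm : ψ.HasConductorExp m)
    (hμ : IsSelfDualMeasure ψ μ)
    (x : LerayMetaplectic μ (isContinuousNontrivial_mulShift_half hψ)
      (isAlt_alt_polar_dotProductBilin (F := F) (ι := ι)) nondegenerate_alt_polar_dotProductBilin orthogonal_prod_bot_top) :
    MpPsi.proj _ (lerayMetaplecticEquivMpPsi hl hb μ hψ hm hμ x) = x.g := by
  rw [lerayMetaplecticEquivMpPsi, MulEquiv.trans_apply]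
  exact (schrodingerLerayImplementerSection hl hb μ hψ hm hμ).proj_toMpPsi _ _

/-- **under `ℂˣ`**: the isomorphism is the identity on the central `ℂˣ`, `Φ(1, a) = (1, a·1)`.
[cite: MoeglinVignerasWaldspurger1987, Chap. 2 II.1 (B)] -/
theorem lerayMetaplecticEquivMpPsi_inl (hψ : ψ.IsContinuousNontrivial) (hm : ψ.HasConductorExp m)
    (hμ : IsSelfDualMeasure ψ μ) (a : ℂˣ) :
    lerayMetaplecticEquivMpPsi hl hb μ hψ hm hμ (TwistedProduct.inl _ a) = MpPsi.ofScalar _ a := by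
  rw [lerayMetaplecticEquivMpPsi, MulEquiv.trans_apply]
  exact (schrodingerLerayImplementerSection hl hb μ hψ hm hμ).toMpPsi_inl _ a

end Junction

end Literature.RepresentationTheory.HeisenbergGroup
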